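import Summits.Ventures.PercRepro.RankLevelSetCoreFiveNineteen

/-!
# PercRepro — THE CORANK-`≥ 26` CORE THEOREM AT LEVEL `5` AT RANK `26` — `#Y` BY A SUM OF BINOMIALS (p7, gen 3; S2)

`c025_core_five_nineteen` (RankLevelSetCoreFiveNineteen) closes the `e`-free core at level `5` at every corank `≥ 26`
for `p ≥ 27`: regime II (`n ≥ 2p`) needs the key `2^{p+5}·2^{14}·C(n, 5) ≤ C(p+5, p)·C(n, p − 1)`, which fails at
`p = 26`, `n = 52` (ratio `1.127`). With `#Y ≥ Σ_{B < s < p} C(n, s)` instead of the single term `C(n, p − 1)` — every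
`s`-subset with `B + 1 ≤ s ≤ p − 1` has rank `> q` (sets of rank `≤ q` have `≤ B` points) and rank `< p` — the key
at `p = 26`, `B = 19` reads `2^{31}·2^{14}·C(n, 5) ≤ C(31, 26)·Σ_{s=20}^{25} C(n, s)`, true at `n = 52` with room
`3.4` and propagated to every `n ≥ 52` by the monotonicity of `C(n, s)/C(n, 5)` in `n`. At `p = 26` regime I is empty
(`n ≥ p + 26 = 2p`). Hence:

* **`ncard_subsets_ncard_mem`** — `#{X ⊆ S : |X| ∈ T} = Σ_{s ∈ T} C(|S|, s)`;
* **`choose_sum_le_midCount_of_bound`** — `Σ_{s ∈ [B+1, p−1]} C(n, s) ≤ #Y(p, q)` from the flat bound `f(q) ≤ B`;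
* **`key_sum_of_base`** — the sum key propagates from its instance at `n₀`;
* **`c025_core_five_nineteen_at_twentysix`** — the `e`-free core at level `5`, rank `26`, every corank `≥ 26`.
Axioms: standard.
-/

open scoped Matroid

namespace PercRepro

namespace ThmN

open Set

variable {α : Type}

/-- **Subsets with a prescribed set of sizes**: `#{X ⊆ ↑S : |X| ∈ T} = Σ_{s ∈ T} C(|S|, s)`. -/
theorem ncard_subsets_ncard_mem (S : Finset α) (T : Finset ℕ) :
    {X : Set α | X ⊆ (S : Set α) ∧ X.ncard ∈ T}.ncard = ∑ s ∈ T, S.card.choose s := by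
  classical
  induction T using Finset.induction_on with
  | empty => simp
  | insert a T ha ih =>
    rw [Finset.sum_insert ha, ← ih, ← ncard_subsets_ncard_eq S a]
    have hset : {X : Set α | X ⊆ (S : Set α) ∧ X.ncard ∈ insert a T} =
        {X : Set α | X ⊆ (S : Set α) ∧ X.ncard = a} ∪ {X : Set α | X ⊆ (S : Set α) ∧ X.ncard ∈ T} := by
      ext X
      simp only [Set.mem_setOf_eq, Set.mem_union, Finset.mem_insert]
      tauto
    have hf1 : {X : Set α | X ⊆ (S : Set α) ∧ X.ncard = a}.Finite :=
      (S.finite_toSet.finite_subsets).subset (fun X hX => hX.1)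
    have hf2 : {X : Set α | X ⊆ (S : Set α) ∧ X.ncard ∈ T}.Finite :=
      (S.finite_toSet.finite_subsets).subset (fun X hX => hX.1)
    have hdisj : Disjoint {X : Set α | X ⊆ (S : Set α) ∧ X.ncard = a}
        {X : Set α | X ⊆ (S : Set α) ∧ X.ncard ∈ T} := by
      rw [Set.disjoint_left]
      intro X h1 h2
      exact ha (h1.2 ▸ h2.2)
    rw [hset, Set.ncard_union_eq hdisj hf1 hf2]

/-- **`Σ_{B < s < p} C(n, s) ≤ #Y(p, q)` from the flat bound**: every `s`-subset of `E` with `B + 1 ≤ s ≤ p − 1`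
has rank `< p` and rank `> q` (a set of rank `≤ q` has `≤ B < s` points). -/
theorem choose_sum_le_midCount_of_bound (M : Matroid α) [M.Finite]
    (hfree : ∀ e ∈ M.E, ∃ A ⊆ M.E \ {e}, e ∉ M.closure A ∧ e ∉ M.closure ((M.E \ {e}) \ A))
    {p q B : ℕ} (hBq : ∀ X ⊆ M.E, M.eRk X ≤ q → X.ncard ≤ B) (hp : B + 2 ≤ p) :
    ∑ s ∈ Finset.Icc (B + 1) (p - 1), M.ground_finite.toFinset.card.choose s ≤ Matroid.midCount M p q := by
  have _hL := not_isLoop_of_free M hfree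
  have hE : (M.ground_finite.toFinset : Set α) = M.E := Set.Finite.coe_toFinset _
  rw [← ncard_subsets_ncard_mem M.ground_finite.toFinset (Finset.Icc (B + 1) (p - 1))]
  unfold Matroid.midCount
  apply Set.ncard_le_ncard
  · intro X hX
    have hXE : X ⊆ M.E := by rw [← hE]; exact hX.1
    have hXfin : X.Finite := M.ground_finite.subset hXE
    have hXc := Finset.mem_Icc.1 hX.2
    refine ⟨hXE, ?_, ?_⟩
    · by_contra hle
      push Not at hle
      have := hBq X hXE hle
      omega
    · calc M.eRk X ≤ X.encard := M.eRk_le_encard X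
        _ = (X.ncard : ℕ∞) := by rw [← hXfin.cast_ncard_eq]
        _ < (p : ℕ∞) := by exact_mod_cast (show X.ncard < p by omega)
  · exact M.ground_finite.finite_subsets.subset (fun X hX => hX.1)

/-- **The sum key from one instance**: `2^{p+q}·K·C(n, q) ≤ C·Σ_{s ∈ T} C(n, s)` at `n = n₀` propagates to every
`n ≥ n₀` when every `s ∈ T` has `q ≤ s ≤ n₀` (the ratio `C(n, s)/C(n, q)` is non-decreasing in `n`). -/
theorem key_sum_of_base (p q K C n₀ : ℕ) (T : Finset ℕ) (hT : ∀ s ∈ T, q ≤ s ∧ s ≤ n₀) (hqn : q ≤ n₀)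
    (hbase : 2 ^ (p + q) * K * n₀.choose q ≤ C * ∑ s ∈ T, n₀.choose s) :
    ∀ n, n₀ ≤ n → 2 ^ (p + q) * K * n.choose q ≤ C * ∑ s ∈ T, n.choose s := by
  intro n hn
  induction n, hn using Nat.le_induction with
  | base => exact hbase
  | succ n hn ih =>
    have hmono : (∑ s ∈ T, n.choose s) * (n + 1).choose q ≤ (∑ s ∈ T, (n + 1).choose s) * n.choose q := by
      rw [Finset.sum_mul, Finset.sum_mul]
      apply Finset.sum_le_sum
      intro s hs
      have h1 := (hT s hs).1
      have h2 := (hT s hs).2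
      have h := choose_ratio_mono_succ n (s + 1) q (by omega) (by omega)
      simpa using h
    have hpos : 0 < n.choose q := Nat.choose_pos (by omega)
    refine Nat.le_of_mul_le_mul_right ?_ hpos
    calc 2 ^ (p + q) * K * (n + 1).choose q * n.choose q
        = (2 ^ (p + q) * K * n.choose q) * (n + 1).choose q := by ring
      _ ≤ (C * ∑ s ∈ T, n.choose s) * (n + 1).choose q := Nat.mul_le_mul_right _ ih
      _ = C * ((∑ s ∈ T, n.choose s) * (n + 1).choose q) := by ring
      _ ≤ C * ((∑ s ∈ T, (n + 1).choose s) * n.choose q) := Nat.mul_le_mul_left _ hmono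
      _ = C * (∑ s ∈ T, (n + 1).choose s) * n.choose q := by ring

/-- `Σ_{s ∈ [20, 25]} g s`, expanded. -/
theorem sum_Icc_twenty_twentyfive (g : ℕ → ℕ) :
    ∑ s ∈ Finset.Icc 20 25, g s = g 20 + g 21 + g 22 + g 23 + g 24 + g 25 := by
  rw [show (25 : ℕ) = 24 + 1 from rfl, Finset.sum_Icc_succ_top (by norm_num),
    show (24 : ℕ) = 23 + 1 from rfl, Finset.sum_Icc_succ_top (by norm_num),
    show (23 : ℕ) = 22 + 1 from rfl, Finset.sum_Icc_succ_top (by norm_num),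
    show (22 : ℕ) = 21 + 1 from rfl, Finset.sum_Icc_succ_top (by norm_num),
    show (21 : ℕ) = 20 + 1 from rfl, Finset.sum_Icc_succ_top (by norm_num), Finset.Icc_self,
    Finset.sum_singleton]

/-- The sum key at `p = 26`, `q = 5`, `B = 19`, `n₀ = 52`: one numeral, decided. -/
theorem key_sum_twentysix_base :
    2 ^ (26 + 5) * 2 ^ (19 - 5) * (52).choose 5 ≤ (26 + 5).choose 26 * ∑ s ∈ Finset.Icc 20 25, (52).choose s := by
  rw [sum_Icc_twenty_twentyfive]
  decide

/-- The regime-II arithmetic with the `Y`-side lower bound an arbitrary natural `S` (night-1's `coreSharp_arith_II`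
with `S` in place of `C(n, p − 1)`). -/
theorem coreSharp_arith_II_of {n p q K S : ℕ} {Φ U Y : ℚ}
    (hΦ : Φ ≤ (2 ^ (p + q) : ℚ) / ((p + q).choose p : ℚ)) (hU0 : 0 ≤ U)
    (hU : U ≤ (n.choose q : ℚ) * K)
    (hkey : 2 ^ (p + q) * K * n.choose q ≤ (p + q).choose p * S)
    (hY : (S : ℚ) ≤ Y) : Φ * U ≤ Y := by
  have hc : (0 : ℚ) < ((p + q).choose p : ℚ) := by exact_mod_cast Nat.choose_pos (Nat.le_add_right p q)
  have hkey' : (2 : ℚ) ^ (p + q) * K * (n.choose q : ℚ) ≤ ((p + q).choose p : ℚ) * (S : ℚ) := by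
    exact_mod_cast hkey
  calc Φ * U ≤ (2 ^ (p + q) : ℚ) / ((p + q).choose p : ℚ) * ((n.choose q : ℚ) * K) :=
        mul_le_mul hΦ hU hU0 (by positivity)
    _ = (2 ^ (p + q) * K * (n.choose q : ℚ)) / ((p + q).choose p : ℚ) := by ring
    _ ≤ (((p + q).choose p : ℚ) * (S : ℚ)) / ((p + q).choose p : ℚ) := by gcongr
    _ = (S : ℚ) := by field_simp
    _ ≤ Y := hY

/-- **The `e`-free core at level `5`, rank `26`, every corank `≥ 26`** (`f(5) ≤ 19`): regime II only (`n ≥ 52 = 2p`),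
with `#Y ≥ Σ_{s=20}^{25} C(n, s)`; the rank hypothesis is not needed (the `U`-count is bounded through the level count). -/
theorem c025_core_five_nineteen_at_twentysix (M : Matroid α) [M.Finite] (hbig : 26 + 25 < M.E.ncard)
    (hfree : ∀ e ∈ M.E, ∃ A ⊆ M.E \ {e}, e ∉ M.closure A ∧ e ∉ M.closure ((M.E \ {e}) \ A)) : RLS M 26 5 := by
  classical
  set n := M.E.ncard with hn_def
  have hEcard : M.ground_finite.toFinset.card = n := by
    rw [hn_def, Set.ncard_eq_toFinset_card _ M.ground_finite]
  have hBq' : ∀ X ⊆ M.E, M.eRk X ≤ 5 → X.ncard ≤ 19 := fun X hX hr =>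
    ncard_le_nineteen_of_eRk_le_five_of_free M hfree hX hr
  have hU : Matroid.topCount M 26 5 ≤ n.choose 5 * 2 ^ (19 - 5) := by
    calc Matroid.topCount M 26 5 ≤ Matroid.levelCount M 5 := Matroid.topCount_le_levelCount_bot 26 5
      _ = {X : Set α | X ⊆ M.E ∧ M.eRk X = 5}.ncard := rfl
      _ ≤ n.choose 5 * 2 ^ (19 - 5) := by rw [← hEcard]; exact ncard_eRk_eq_le_choose_mul_of_bound M 5 19 hBq'
  have hΦ := phiK_le_two_pow_div 26 5
  have hU0 : (0 : ℚ) ≤ (Matroid.topCount M 26 5 : ℚ) := by positivity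
  have hUq' : (Matroid.topCount M 26 5 : ℚ) ≤ (n.choose 5 : ℚ) * ((2 ^ (19 - 5) : ℕ) : ℚ) := by
    exact_mod_cast hU
  have hY := choose_sum_le_midCount_of_bound M hfree hBq' (show 19 + 2 ≤ 26 by norm_num)
  rw [hEcard] at hY
  have key := key_sum_of_base 26 5 (2 ^ (19 - 5)) ((26 + 5).choose 26) 52 (Finset.Icc 20 25)
    (fun s hs => by rw [Finset.mem_Icc] at hs; omega) (by norm_num)
  have hkey := key key_sum_twentysix_base n (by omega)
  have hYq : ((∑ s ∈ Finset.Icc (19 + 1) (26 - 1), n.choose s : ℕ) : ℚ) ≤ (Matroid.midCount M 26 5 : ℚ) := by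
    exact_mod_cast hY
  rw [RLS_iff]
  exact coreSharp_arith_II_of hΦ hU0 hUq' hkey hYq

end ThmN

end PercRepro
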